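import Mathlib.Analysis.SpecialFunctions.Pow.Real
import Mathlib.Analysis.SpecialFunctions.Log.Basic
import Mathlib.Analysis.SpecialFunctions.Pow.Asymptotics
import Mathlib.Analysis.Real.Pi.Bounds
import Mathlib.Analysis.Complex.ExponentialBounds
import HarnessLib

/-!
# Conrey–Iwaniec (2002), §4: absorption of the constants of Theorem 4.1 into `q⁶X^{3/4}(log 3X)²`

B. Conrey, H. Iwaniec, *Spacing of zeros of Hecke `L`-functions and the class number problem*,
Acta Arith. 103 (2002), Corollary 4.2 (4.19), Theorems 4.3/4.4 (4.25)/(4.26) [held text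
`paper:arxiv-math_0111012`, p0011–p0012]. Registered stub S3f `stub_absorb_constants` of SKELETON S3
(cell `landau-siegel/ls-inputs`, line `theta-circle-method`), PROVED: with `A = 2π + √q·ℓ`,
`0 ≤ ℓ ≤ log q` (`ℓ = L(1,χ)`), `B = B₀q^{3/2}`, `C = 2√(qX)`, `q ≥ 5`, `X ≥ 1/2`, the error of
Theorem 4.1, `c₀A²(C⁻¹X + qB²C^{3/2}log²C)` — written `c₀A²(X/√(qX) + qB²(qX)^{3/4}(1+log qX)²)` —
is at most `c·q⁶X^{3/4}log²(3X)`. This is the bookkeeping behind print's "`O(τ(h)(qAB)²X^{3/4}(log 3X)²)`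
… `A = 2√qL(1,χ)`, `B = k²q^{3/2}`" giving "`τ(h)q⁶k⁴X^{3/4}(log 3X)²`": `q·q^{3/4}·A²B² ≍ q^{23/4}L(1,χ)²`
and `L(1,χ)²(log q)² ≪ q^{1/4}`. Elementary real inequalities only (`log q ≤ 16q^{1/16}`,
`√X ≤ 2X^{3/4}`, `1 + log(qX) ≤ 1 + log q + log 3X`, `log(3X) ≥ 1/3`).

## References

* [ConreyIwaniec2002] B. Conrey, H. Iwaniec, Acta Arith. 103 (2002) 259–312, arXiv:math/0111012:
  Corollary 4.2 (4.19); Theorem 4.3 (4.25); Theorem 4.4 (4.26).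
-/

noncomputable section

namespace Literature.NumberTheory.LFunctions

namespace ConreyIwaniec2002

/-- `√X ≤ 2X^{3/4}` for `X ≥ 1/2`. [folklore] -/
private theorem sqrt_le_two_mul_rpow_three_quarters {X : ℝ} (hX : 1 / 2 ≤ X) :
    Real.sqrt X ≤ 2 * X ^ (3 / 4 : ℝ) := by
  have hX0 : 0 < X := by linarith
  rw [Real.sqrt_eq_rpow]
  rcases le_or_gt 1 X with hX1 | hX1
  · calc X ^ (1 / 2 : ℝ) ≤ X ^ (3 / 4 : ℝ) :=
          Real.rpow_le_rpow_of_exponent_le hX1 (by norm_num)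
      _ ≤ 2 * X ^ (3 / 4 : ℝ) := by
          have : 0 ≤ X ^ (3 / 4 : ℝ) := Real.rpow_nonneg hX0.le _
          linarith
  · have h1 : X ^ (1 / 2 : ℝ) ≤ 1 := Real.rpow_le_one hX0.le hX1.le (by norm_num)
    have h2 : X ≤ X ^ (3 / 4 : ℝ) := by
      have := Real.rpow_le_rpow_of_exponent_ge hX0 hX1.le (show (3 / 4 : ℝ) ≤ 1 by norm_num)
      rwa [Real.rpow_one] at this
    linarith

/-- `log(3X) ≥ 1/3` for `X ≥ 1/2` (`log y ≥ 1 − 1/y`). [folklore] -/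
private theorem third_le_log_three_mul {X : ℝ} (hX : 1 / 2 ≤ X) : 1 / 3 ≤ Real.log (3 * X) := by
  have h32 : (0 : ℝ) < 3 * X := by linarith
  have h1 := Real.one_sub_inv_le_log_of_pos h32
  have h2 : (3 * X)⁻¹ ≤ 2 / 3 := by
    rw [inv_eq_one_div, div_le_div_iff₀ h32 (by norm_num)]
    linarith
  linarith

/-- `1 ≤ log q` for `q ≥ 5`. [folklore] -/
private theorem one_le_log_of_five_le {q : ℝ} (hq : 5 ≤ q) : 1 ≤ Real.log q := by
  have he : Real.exp 1 ≤ q := by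
    have := Real.exp_one_lt_d9
    linarith
  calc (1 : ℝ) = Real.log (Real.exp 1) := (Real.log_exp 1).symm
    _ ≤ Real.log q := Real.log_le_log (Real.exp_pos 1) he

/-- `(log q)⁴ ≤ 65536·q^{1/4}` for `q > 0` (`log q ≤ 16q^{1/16}`). [folklore] -/
private theorem log_pow_four_le {q : ℝ} (hq : 1 ≤ q) : Real.log q ^ 4 ≤ 65536 * q ^ (1 / 4 : ℝ) := by
  have hq0 : 0 ≤ q := by linarith
  have h1 : Real.log q ≤ 16 * q ^ (1 / 16 : ℝ) := by
    have := Real.log_le_rpow_div hq0 (show (0 : ℝ) < 1 / 16 by norm_num)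
    linarith [this]
  have hlog0 : 0 ≤ Real.log q := Real.log_nonneg hq
  calc Real.log q ^ 4 ≤ (16 * q ^ (1 / 16 : ℝ)) ^ 4 := pow_le_pow_left₀ hlog0 h1 4
    _ = 65536 * (q ^ (1 / 16 : ℝ)) ^ (4 : ℕ) := by ring
    _ = 65536 * q ^ (1 / 4 : ℝ) := by
        rw [← Real.rpow_natCast, ← Real.rpow_mul hq0]
        norm_num

/-- **S3f — absorption of the constants** (registered stub `stub_absorb_constants` of SKELETON S3,
statement verbatim): with `A = 2π + √q·ℓ`, `0 ≤ ℓ ≤ log q`, `B = B₀q^{3/2}`, `q ≥ 5`, `X ≥ 1/2`: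
`c₀A²(X/√(qX) + qB²(qX)^{3/4}(1+log qX)²) ≤ c·q⁶X^{3/4}log²(3X)`; one may take
`c = 1350·65536·c₀B₀²`. Print's "`(qAB)²X^{3/4}(log 3X)²`" of (4.19)/(4.25)/(4.26) with
`A = 2√qL(1,χ)`, `B = q^{3/2}`, the factor `L(1,χ)²log²q` absorbed by `q^{1/4}`.
[cite: ConreyIwaniec2002, Corollary 4.2 (4.19), Theorem 4.3 (4.25), Theorem 4.4 (4.26)] -/
theorem circleMethod_absorb_constants :
    ∀ (c₀ B₀ : ℝ), 0 < c₀ → 1 ≤ B₀ → ∃ c : ℝ, 0 < c ∧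
      ∀ (q X ℓ : ℝ), 5 ≤ q → 1 / 2 ≤ X → 0 ≤ ℓ → ℓ ≤ Real.log q →
        c₀ * (2 * Real.pi + Real.sqrt q * ℓ) ^ 2 *
            (X / Real.sqrt (q * X) +
              q * (B₀ * q ^ (3 / 2 : ℝ)) ^ 2 * (q * X) ^ (3 / 4 : ℝ) * (1 + Real.log (q * X)) ^ 2) ≤
          c * q ^ (6 : ℕ) * X ^ (3 / 4 : ℝ) * Real.log (3 * X) ^ 2 := by
  intro c₀ B₀ hc₀ hB₀
  refine ⟨1350 * 65536 * c₀ * B₀ ^ 2, by positivity, ?_⟩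
  intro q X ℓ hq hX hℓ hℓq
  set L := Real.log q with hL
  set M := Real.log (3 * X) with hM
  have hq0 : 0 < q := by linarith
  have hX0 : 0 < X := by linarith
  have hq1 : 1 ≤ q := by linarith
  have hL1 : 1 ≤ L := one_le_log_of_five_le hq
  have hM3 : 1 / 3 ≤ M := third_le_log_three_mul hX
  have hM0 : 0 < M := by linarith
  have hM9 : 1 ≤ 9 * M ^ 2 := by nlinarith [hM3]
  have hL2 : 1 ≤ L ^ 2 := by nlinarith [hL1]
  have hB2 : 1 ≤ B₀ ^ 2 := by nlinarith [hB₀]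
  have hX34 : 0 < X ^ (3 / 4 : ℝ) := Real.rpow_pos_of_pos hX0 _
  have hq194 : 1 ≤ q ^ (19 / 4 : ℝ) := Real.one_le_rpow hq1 (by norm_num)
  -- `A² ≤ 18 q L²`
  have hA : (2 * Real.pi + Real.sqrt q * ℓ) ^ 2 ≤ 18 * q * L ^ 2 := by
    have hsq : Real.sqrt q ^ 2 = q := Real.sq_sqrt hq0.le
    have h1 : (2 * Real.pi + Real.sqrt q * ℓ) ^ 2 ≤
        2 * (2 * Real.pi) ^ 2 + 2 * (Real.sqrt q * ℓ) ^ 2 := by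
      nlinarith [sq_nonneg (2 * Real.pi - Real.sqrt q * ℓ)]
    have h2 : (Real.sqrt q * ℓ) ^ 2 ≤ q * L ^ 2 := by
      rw [mul_pow, hsq]
      exact mul_le_mul_of_nonneg_left (pow_le_pow_left₀ hℓ hℓq 2) hq0.le
    have h3 : 2 * (2 * Real.pi) ^ 2 ≤ 80 := by nlinarith [Real.pi_pos, Real.pi_lt_d2]
    have h4 : (5 : ℝ) ≤ q * L ^ 2 := by
      calc (5 : ℝ) = 5 * 1 := by ring
        _ ≤ q * L ^ 2 := mul_le_mul hq hL2 (by norm_num) hq0.le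
    linarith [h1, h2, h3, h4]
  -- first term
  have hT1 : X / Real.sqrt (q * X) ≤ 2 * X ^ (3 / 4 : ℝ) := by
    have h1 : X / Real.sqrt (q * X) ≤ X / Real.sqrt X :=
      div_le_div_of_nonneg_left hX0.le (Real.sqrt_pos.2 hX0) (Real.sqrt_le_sqrt (by nlinarith))
    rw [Real.div_sqrt] at h1
    exact h1.trans (sqrt_le_two_mul_rpow_three_quarters hX)
  -- the logarithm
  have hlog : (1 + Real.log (q * X)) ^ 2 ≤ 57 * L ^ 2 * M ^ 2 := by
    have hqX : Real.log (q * X) = L + Real.log X := Real.log_mul hq0.ne' hX0.ne'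
    have hX3 : Real.log X = M - Real.log 3 := by
      rw [hM, Real.log_mul (by norm_num) hX0.ne']; ring
    have hlog3 : 0 ≤ Real.log 3 := Real.log_nonneg (by norm_num)
    have hup : 1 + Real.log (q * X) ≤ 1 + L + M := by rw [hqX, hX3]; linarith
    have hlow : 0 ≤ 1 + Real.log (q * X) := by
      have : 0 ≤ Real.log (q * X) := Real.log_nonneg (by nlinarith)
      linarith
    have h1 : (1 + Real.log (q * X)) ^ 2 ≤ (1 + L + M) ^ 2 := pow_le_pow_left₀ hlow hup 2
    have h2 : (1 + L + M) ^ 2 ≤ 3 * (1 + L ^ 2 + M ^ 2) := by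
      nlinarith [sq_nonneg (1 - L), sq_nonneg (1 - M), sq_nonneg (L - M)]
    have h3 : M ^ 2 ≤ L ^ 2 * M ^ 2 := le_mul_of_one_le_left (sq_nonneg M) hL2
    have h4 : L ^ 2 ≤ 9 * L ^ 2 * M ^ 2 := by
      have := le_mul_of_one_le_left (sq_nonneg L) hM9
      linarith [this]
    linarith [h1, h2, h3, h4, hM9]
  -- second term
  have e1 : (q ^ (3 / 2 : ℝ)) ^ 2 = q ^ (3 : ℝ) := by
    rw [← Real.rpow_natCast, ← Real.rpow_mul hq0.le]; norm_num
  have e2 : (q * X) ^ (3 / 4 : ℝ) = q ^ (3 / 4 : ℝ) * X ^ (3 / 4 : ℝ) := Real.mul_rpow hq0.le hX0.le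
  have e3 : q * q ^ (3 : ℝ) * q ^ (3 / 4 : ℝ) = q ^ (19 / 4 : ℝ) := by
    rw [show (19 / 4 : ℝ) = 1 + 3 + 3 / 4 by norm_num, Real.rpow_add hq0, Real.rpow_add hq0,
      Real.rpow_one]
  have hT2 : q * (B₀ * q ^ (3 / 2 : ℝ)) ^ 2 * (q * X) ^ (3 / 4 : ℝ) * (1 + Real.log (q * X)) ^ 2 ≤
      B₀ ^ 2 * q ^ (19 / 4 : ℝ) * X ^ (3 / 4 : ℝ) * (57 * L ^ 2 * M ^ 2) := by
    have heq : q * (B₀ * q ^ (3 / 2 : ℝ)) ^ 2 * (q * X) ^ (3 / 4 : ℝ) =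
        B₀ ^ 2 * q ^ (19 / 4 : ℝ) * X ^ (3 / 4 : ℝ) := by
      rw [mul_pow, e1, e2, ← e3]; ring
    rw [heq]
    exact mul_le_mul_of_nonneg_left hlog (by positivity)
  -- the bracket
  have hbr : X / Real.sqrt (q * X) +
      q * (B₀ * q ^ (3 / 2 : ℝ)) ^ 2 * (q * X) ^ (3 / 4 : ℝ) * (1 + Real.log (q * X)) ^ 2 ≤
      75 * B₀ ^ 2 * q ^ (19 / 4 : ℝ) * X ^ (3 / 4 : ℝ) * L ^ 2 * M ^ 2 := by
    have h1 : 2 * X ^ (3 / 4 : ℝ) ≤ 18 * B₀ ^ 2 * q ^ (19 / 4 : ℝ) * X ^ (3 / 4 : ℝ) * L ^ 2 * M ^ 2 := by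
      have h18 : 2 * X ^ (3 / 4 : ℝ) ≤ 18 * M ^ 2 * X ^ (3 / 4 : ℝ) :=
        mul_le_mul_of_nonneg_right (by linarith [hM9]) hX34.le
      have hrest : 18 * M ^ 2 * X ^ (3 / 4 : ℝ) ≤
          18 * B₀ ^ 2 * q ^ (19 / 4 : ℝ) * X ^ (3 / 4 : ℝ) * L ^ 2 * M ^ 2 := by
        have hprod : (1 : ℝ) ≤ B₀ ^ 2 * q ^ (19 / 4 : ℝ) * L ^ 2 := by
          calc (1 : ℝ) = 1 * 1 * 1 := by ring
            _ ≤ B₀ ^ 2 * q ^ (19 / 4 : ℝ) * L ^ 2 := by gcongr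
        have hpos : 0 ≤ 18 * M ^ 2 * X ^ (3 / 4 : ℝ) := by positivity
        calc 18 * M ^ 2 * X ^ (3 / 4 : ℝ) = 18 * M ^ 2 * X ^ (3 / 4 : ℝ) * 1 := by ring
          _ ≤ 18 * M ^ 2 * X ^ (3 / 4 : ℝ) * (B₀ ^ 2 * q ^ (19 / 4 : ℝ) * L ^ 2) :=
              mul_le_mul_of_nonneg_left hprod hpos
          _ = 18 * B₀ ^ 2 * q ^ (19 / 4 : ℝ) * X ^ (3 / 4 : ℝ) * L ^ 2 * M ^ 2 := by ring
      exact h18.trans hrest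
    linarith [hT1, hT2, h1]
  -- powers of `q`
  have hL4 : L ^ 4 ≤ 65536 * q ^ (1 / 4 : ℝ) := log_pow_four_le hq1
  have e4 : q * q ^ (19 / 4 : ℝ) * q ^ (1 / 4 : ℝ) = q ^ (6 : ℕ) := by
    rw [← Real.rpow_natCast, show ((6 : ℕ) : ℝ) = 1 + 19 / 4 + 1 / 4 by norm_num,
      Real.rpow_add hq0, Real.rpow_add hq0, Real.rpow_one]
  -- assembly
  have hA0 : 0 ≤ (2 * Real.pi + Real.sqrt q * ℓ) ^ 2 := sq_nonneg _
  have hbr0 : 0 ≤ X / Real.sqrt (q * X) +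
      q * (B₀ * q ^ (3 / 2 : ℝ)) ^ 2 * (q * X) ^ (3 / 4 : ℝ) * (1 + Real.log (q * X)) ^ 2 := by
    positivity
  calc c₀ * (2 * Real.pi + Real.sqrt q * ℓ) ^ 2 *
        (X / Real.sqrt (q * X) +
          q * (B₀ * q ^ (3 / 2 : ℝ)) ^ 2 * (q * X) ^ (3 / 4 : ℝ) * (1 + Real.log (q * X)) ^ 2)
      ≤ c₀ * (18 * q * L ^ 2) * (75 * B₀ ^ 2 * q ^ (19 / 4 : ℝ) * X ^ (3 / 4 : ℝ) * L ^ 2 * M ^ 2) :=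
        mul_le_mul (mul_le_mul_of_nonneg_left hA hc₀.le) hbr hbr0 (by positivity)
    _ = 1350 * c₀ * B₀ ^ 2 * (q * q ^ (19 / 4 : ℝ)) * X ^ (3 / 4 : ℝ) * M ^ 2 * L ^ 4 := by ring
    _ ≤ 1350 * c₀ * B₀ ^ 2 * (q * q ^ (19 / 4 : ℝ)) * X ^ (3 / 4 : ℝ) * M ^ 2 *
          (65536 * q ^ (1 / 4 : ℝ)) :=
        mul_le_mul_of_nonneg_left hL4 (by positivity)
    _ = 1350 * 65536 * c₀ * B₀ ^ 2 * (q * q ^ (19 / 4 : ℝ) * q ^ (1 / 4 : ℝ)) * X ^ (3 / 4 : ℝ) *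
          M ^ 2 := by ring
    _ = 1350 * 65536 * c₀ * B₀ ^ 2 * q ^ (6 : ℕ) * X ^ (3 / 4 : ℝ) * Real.log (3 * X) ^ 2 := by
        rw [e4]

end ConreyIwaniec2002

end Literature.NumberTheory.LFunctions

end
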